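import Summits.QuantumFields.YangMills.Theorems.BalabanUVNodesN15KingModelBlockCovarianceIdentity
import Literature.MathematicalPhysics.QuantumFieldTheory.King1986.MinimizerFourier

/-!
# BalabanUVNodes ∕ N15 — THE KING-MODEL RUNG (PART Ϡ-d): THE EXACT PLANE-WAVE FORMULA FOR NE2's UNIT-LAYER KERNEL IN THE MODEL —
# `(Δ^{(K)})⁻¹(b, b′) = a_K⁻¹·[b = b′] + |Ω|⁻¹ Σ_{q ∈ Ω̂} S_K(q)·Re e^{iq·(b′ − b)}`, `S_K(q) = Σ_{p ∈ fib q} |u(p)|²∕σ(p)` (King's alias sum of (4.5))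
# (Track A, DAG node N15 = NE2; FAN-OUT v1.1 §N15 s3 «KING-MODEL RUNG … NE2's analogue DECIDED in the model»)

HONEST FRAMING.  Count-neutral (cell `pub-ymgap`, seat `pub-ymgap-dag-n15-e` g32; `--supports stmt-QuantumFields-27366 --as helper` = K3⁸
`SpineGivenEndpointR13SepCoPHV`).  TEMPLATE LITERATURE: C. King, *The U(1) Higgs model. I. The continuum limit*, Commun. Math. Phys. **102** (1986) 649–677
[King1986] — KING's OWN `A = 0` MODEL on the unit torus `Ω = Tor M` (fine torus `Tor (fine N M)`, `N = L^K`): the effective Laplacian `Δ^{(K)} = a − a²N^dQA₀⁻¹Qᵀ`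
((2.14)∕(4.5); tree `Torus.effLaplacian`), the block mean `Q` ((2.10); `Qmat`), the massive free operator `B = N²(−Δ) + m²` ((4.4); `lapF`), King's alias sum `S(q) =
Σ_{p ∈ fib q}|u(p)|²∕σ(p)` ((4.5); `Sfib`), the plane waves `e^{iq·x}` (`chi`) and transform `φ̃` (`ft`) of (4.1)∕(4.35), and the rung's g0 kernel `blockCov =
(Δ^{(K)})⁻¹(b, b′)` (`…N15KingModelRungUnit`).  NOT Bałaban's `C^{(k)}(Λ)`; NOT a node discharge (N15 is booked through n15-a's knit, untouched here); nothing
continuum-Yang–Mills ∕ ℝ⁴ ∕ OS ∕ mass-gap ∕ Clay.  0 `sorry`; standard axioms; 0 `def`.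

THE MATHEMATICS.  Part Ϛ (250) proved the Woodbury form of (2.14), `(Δ^{(K)})⁻¹ = a_K⁻¹·1 + N^d·Q B⁻¹ Qᵀ`.  The tree's fibre computation `inv_sandwich_form`
(seat n18-b, `King1986/EffectiveLaplacianSymbol`: `|Ω_η|⟨Qᵀφ, A₀⁻¹Qᵀφ⟩ = Σ_q S(q)∕(1 + aS(q))·|φ̃(q)|²`) AT `a = 0` (`A₀ = B`) is the plane-wave form of the
block-averaged free propagator: `N^d⟨φ, QB⁻¹Qᵀφ⟩ = |Ω|⁻¹Σ_q S(q)|φ̃(q)|²` (§1).  `QB⁻¹Qᵀ` is symmetric, so POLARIZATION with `φ = δ_b + δ_{b′}`, `δ̃_b(q) =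
e^{−iq·b}` and `|e^{−iq·b} + e^{−iq·b′}|² = 2 + 2Re e^{iq·(b′−b)}` gives the ENTRIES: `N^d(QB⁻¹Qᵀ)(b, b′) = |Ω|⁻¹Σ_q S(q)Re e^{iq·(b′−b)}` (§2), hence the exact
kernel formula for `(Δ^{(K)})⁻¹` and for the rung's `blockCov` (§3).  With part Ϡ-c (`S_{L^K}(q) → S_∞(p′(q))`, `a_K → a_∞`) this finite sum passes to the
`K → ∞` limit term by term (part Ϡ-e).

WHAT THIS FILE PROVES (kernel).  §1 `fineOp_zero` (`A₀|_{a=0} = B`), `ft_add'` (linearity of `φ̃`), ★★ **`blockAvg_form`** (`N^d⟨φ, QB⁻¹Qᵀφ⟩ = |Ω|⁻¹Σ_q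
S(q)|φ̃(q)|²`).  §2 `blockAvg_transpose` (symmetry), `polarization_entry` (generic: a symmetric real matrix's entry from three quadratic forms), `normSq_ft_single`,
`normSq_ft_single_add` (`|δ̃_b + δ̃_{b′}|²(q) = 2 + 2Re e^{iq·(b′−b)}`), ★★★ **`blockAvg_apply_eq_fourier`** (`N^d(QB⁻¹Qᵀ)(b,b′) = |Ω|⁻¹Σ_q S(q)Re e^{iq·(b′−b)}`).
§3 ★★★ **`effLaplacian_inv_apply_eq_fourier`** (`(Δ^{(K)})⁻¹(b,b′) = a⁻¹[b = b′] + |Ω|⁻¹Σ_q S(q)Re e^{iq·(b′−b)}`, every `N ≥ 1`, `a, m² > 0`, `c = N²`) and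
★★★ **`blockCov_eq_fourier`** (the rung's NE2 unit-layer kernel, every `K`, every unit torus `M`).

HONEST SCOPE.  Exact identities in King's `A = 0` model; nothing estimated.  The curved case (Bałaban's `Δ^{(k)}(U)`) has no plane-wave representation and is not
addressed.  N15 untouched; counts unmoved.  Locators: [King1986] (2.10), (2.13)–(2.14) p.653, (4.1)–(4.5) p.670, (4.35)–(4.36) p.674, (4.44)–(4.45) p.675.
-/

noncomputable section

open scoped BigOperators ComplexConjugate
open Finset Matrix Complex

namespace Summit.QuantumFields.YangMills.BalabanUVNodes.N15KingModelRung

open Literature.MathematicalPhysics.QuantumFieldTheory.Balaban1983to89.B5Prop11Plancherel (Tor fine chi)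
open Literature.MathematicalPhysics.QuantumFieldTheory.Balaban1983to89
open Literature.MathematicalPhysics.QuantumFieldTheory.King1986 (aK aK_pos)
open Literature.MathematicalPhysics.QuantumFieldTheory.King1986.Torus

variable {d : ℕ}

/-! ## §1 The block-averaged free propagator in momentum space -/

section Form

variable (N : ℕ) [NeZero N] (M : Fin d → ℕ) [hM : ∀ μ, NeZero (M μ)]

/-- `A₀` at `a = 0` is the massive free operator `B = c(−Δ) + m²`. [cite: King1986, (4.4)–(4.5) p.670] -/
theorem fineOp_zero (c m2 : ℝ) : fineOp N M 0 c m2 = lapF (fine N M) c m2 := by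
  rw [fineOp, zero_smul, add_zero]

omit [NeZero N] in
/-- Linearity of King's transform: `(φ + ψ)~ = φ̃ + ψ̃`. [cite: King1986, (4.1) p.670] -/
theorem ft_add' (x y : Tor M → ℝ) (q : Tor M) : ft M (x + y) q = ft M x q + ft M y q := by
  unfold ft
  rw [← Finset.sum_add_distrib]
  refine Finset.sum_congr rfl fun z _ => ?_
  rw [Pi.add_apply]
  push_cast
  ring

/-- ★★ **THE BLOCK-AVERAGED FREE PROPAGATOR IN PLANE WAVES**: `N^d·⟨φ, Q B⁻¹ Qᵀ φ⟩ = |Ω|⁻¹ Σ_q S(q)·|φ̃(q)|²` (`c ≥ 0`, `m² > 0`) — the tree's fibre form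
`inv_sandwich_form` at `a = 0` with `|Ω_η| = N^d|Ω|`. [cite: King1986, (4.5) p.670, (4.35)–(4.36) p.674] -/
theorem blockAvg_form {c m2 : ℝ} (hc : 0 ≤ c) (hm : 0 < m2) (φ : Tor M → ℝ) :
    (N : ℝ) ^ d * (φ ⬝ᵥ ((Qmat N M * (lapF (fine N M) c m2)⁻¹ * (Qmat N M)ᵀ) *ᵥ φ))
      = (Fintype.card (Tor M) : ℝ)⁻¹ * ∑ q : Tor M, Sfib N M c m2 q * ‖ft M φ q‖ ^ 2 := by
  have hsand : φ ⬝ᵥ ((Qmat N M * (lapF (fine N M) c m2)⁻¹ * (Qmat N M)ᵀ) *ᵥ φ)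
      = ((Qmat N M)ᵀ *ᵥ φ) ⬝ᵥ ((lapF (fine N M) c m2)⁻¹ *ᵥ ((Qmat N M)ᵀ *ᵥ φ)) := by
    rw [← Matrix.mulVec_mulVec, ← Matrix.mulVec_mulVec, Matrix.dotProduct_mulVec, ← Matrix.mulVec_transpose]
  have hS := inv_sandwich_form N M (a := 0) le_rfl hc hm φ
  rw [fineOp_zero, B5Block118.card_fine N M] at hS
  simp only [zero_mul, add_zero, div_one] at hS
  have hcM : (Fintype.card (Tor M) : ℝ) ≠ 0 := by exact_mod_cast Fintype.card_ne_zero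
  rw [hsand, ← hS]
  field_simp

end Form

/-! ## §2 Polarization: the entries of `N^d·Q B⁻¹ Qᵀ` -/

section Entries

variable (N : ℕ) [NeZero N] (M : Fin d → ℕ) [hM : ∀ μ, NeZero (M μ)]

/-- `Q B⁻¹ Qᵀ` is symmetric (`B` is). [cite: King1986, (4.4) p.670] -/
theorem blockAvg_transpose (c m2 : ℝ) :
    (Qmat N M * (lapF (fine N M) c m2)⁻¹ * (Qmat N M)ᵀ)ᵀ = Qmat N M * (lapF (fine N M) c m2)⁻¹ * (Qmat N M)ᵀ := by
  have hB : (lapF (fine N M) c m2)ᵀ = lapF (fine N M) c m2 := by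
    ext z z'
    rw [Matrix.transpose_apply, lapF_comm]
  rw [Matrix.transpose_mul, Matrix.transpose_mul, Matrix.transpose_transpose, Matrix.transpose_nonsing_inv, hB, Matrix.mul_assoc]

/-- POLARIZATION for a symmetric real matrix: `P(i,j) = ½[(δ_i+δ_j)ᵀP(δ_i+δ_j) − δ_iᵀPδ_i − δ_jᵀPδ_j]`. [cite: King1986, (4.35) p.674] -/
theorem polarization_entry (P : Matrix (Tor M) (Tor M) ℝ) (hP : Pᵀ = P) (i j : Tor M) :
    P i j = ((Pi.single i 1 + Pi.single j 1) ⬝ᵥ (P *ᵥ (Pi.single i 1 + Pi.single j 1))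
      - Pi.single i 1 ⬝ᵥ (P *ᵥ Pi.single i 1) - Pi.single j 1 ⬝ᵥ (P *ᵥ Pi.single j 1)) / 2 := by
  have e : ∀ k l : Tor M, Pi.single k (1 : ℝ) ⬝ᵥ (P *ᵥ Pi.single l 1) = P k l := by
    intro k l
    rw [single_one_dotProduct, Matrix.mulVec_single_one, Matrix.col_apply]
  have hsym : P j i = P i j := by
    have h := congrFun (congrFun hP i) j
    rwa [Matrix.transpose_apply] at h
  rw [Matrix.mulVec_add, dotProduct_add, add_dotProduct, add_dotProduct, e, e, e, e, hsym]
  ring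

/-- `|δ̃_b(q)|² = 1` (`δ̃_b(q) = e^{−iq·b}` is unimodular). [cite: King1986, (4.1) p.670] -/
theorem normSq_ft_single (b q : Tor M) : ‖ft M (Pi.single b 1) q‖ ^ 2 = 1 := by
  have hchi : ∀ x : Tor M, ‖chi M q x‖ = 1 := fun x => by
    unfold chi
    rw [norm_prod]
    exact Finset.prod_eq_one fun μ _ => by rw [ZMod.stdAddChar_apply, Circle.norm_coe]
  rw [ft_single, Complex.norm_conj, hchi, one_pow]

/-- `|δ̃_b(q) + δ̃_{b′}(q)|² = 2 + 2Re e^{iq·(b′ − b)}`. [cite: King1986, (4.1) p.670, (4.35) p.674] -/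
theorem normSq_ft_single_add (b b' q : Tor M) :
    ‖ft M (Pi.single b 1 + Pi.single b' 1) q‖ ^ 2 = 2 + 2 * (chi M q (b' - b)).re := by
  have hchi : ∀ x : Tor M, ‖chi M q x‖ = 1 := fun x => by
    unfold chi
    rw [norm_prod]
    exact Finset.prod_eq_one fun μ _ => by rw [ZMod.stdAddChar_apply, Circle.norm_coe]
  rw [ft_add', ft_single, ft_single, Complex.sq_norm, Complex.normSq_add, ← Complex.sq_norm, ← Complex.sq_norm, Complex.norm_conj,
    Complex.norm_conj, hchi, hchi, Complex.conj_conj, conj_chi_mul_chi]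
  ring

/-- ★★★ **THE ENTRIES OF THE BLOCK-AVERAGED FREE PROPAGATOR**: `N^d·(Q B⁻¹ Qᵀ)(b, b′) = |Ω|⁻¹ Σ_q S(q)·Re e^{iq·(b′ − b)}` (`c ≥ 0`, `m² > 0`) — polarization
of `blockAvg_form`. [cite: King1986, (4.5) p.670, (4.35)–(4.36) p.674] -/
theorem blockAvg_apply_eq_fourier {c m2 : ℝ} (hc : 0 ≤ c) (hm : 0 < m2) (b b' : Tor M) :
    (N : ℝ) ^ d * (Qmat N M * (lapF (fine N M) c m2)⁻¹ * (Qmat N M)ᵀ) b b'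
      = (Fintype.card (Tor M) : ℝ)⁻¹ * ∑ q : Tor M, Sfib N M c m2 q * (chi M q (b' - b)).re := by
  have hP := blockAvg_transpose N M c m2
  have hpol := polarization_entry M _ hP b b'
  have h1 := blockAvg_form N M hc hm (Pi.single b 1 + Pi.single b' 1)
  have h2 := blockAvg_form N M hc hm (Pi.single b 1)
  have h3 := blockAvg_form N M hc hm (Pi.single b' 1)
  simp_rw [normSq_ft_single_add] at h1
  simp_rw [normSq_ft_single] at h2 h3
  rw [hpol, mul_div_assoc', mul_sub, mul_sub, h1, h2, h3, ← mul_sub, ← mul_sub, ← Finset.sum_sub_distrib, ← Finset.sum_sub_distrib,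
    mul_div_assoc]
  congr 1
  rw [div_eq_iff two_ne_zero, Finset.sum_mul]
  exact Finset.sum_congr rfl fun q _ => by ring

end Entries

/-! ## §3 The exact kernel formula for `(Δ^{(K)})⁻¹` and for the rung's `blockCov` -/

section Kernel

variable (N : ℕ) [NeZero N] (M : Fin d → ℕ) [hM : ∀ μ, NeZero (M μ)]

/-- ★★★ **THE EXACT PLANE-WAVE FORMULA FOR THE BLOCK-FIELD COVARIANCE**: for `N ≥ 1`, `a > 0`, `m² > 0`, `c = N²`,
`(Δ^{(K)})⁻¹(b, b′) = a⁻¹·[b = b′] + |Ω|⁻¹ Σ_{q ∈ Ω̂} S(q)·Re e^{iq·(b′ − b)}` — block-spin white noise plus the block-averaged massive free propagator in King's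
(4.5) variables (part Ϛ's Woodbury split + §2). [cite: King1986, (2.13)–(2.14) p.653, (4.5) p.670, (4.35) p.674, (4.44)–(4.45) p.675] -/
theorem effLaplacian_inv_apply_eq_fourier (hN1 : 1 ≤ N) {a m2 : ℝ} (ha : 0 < a) (hm : 0 < m2) (b b' : Tor M) :
    (effLaplacian N M a ((N : ℝ) ^ 2) m2)⁻¹ b b'
      = a⁻¹ * (if b = b' then 1 else 0)
        + (Fintype.card (Tor M) : ℝ)⁻¹ * ∑ q : Tor M, Sfib N M ((N : ℝ) ^ 2) m2 q * (chi M q (b' - b)).re := by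
  rw [effLaplacian_inv_eq_noise_add_blockAvg N M hN1 ha hm, Matrix.add_apply, Matrix.smul_apply, Matrix.smul_apply, Matrix.one_apply, smul_eq_mul,
    smul_eq_mul, blockAvg_apply_eq_fourier N M (by positivity) hm b b']

end Kernel

section Rung

variable (L : ℕ) [NeZero L]

omit [NeZero L] in
/-- ★★★ **NE2's UNIT-LAYER KERNEL OF THE MODEL IN PLANE WAVES, EVERY LEVEL**: for the rung's `blockCov` (`Nf ≥ 1` sites per block side, `a_K = aK a L K > 0`,
`m² > 0`, any unit torus `M`), `(Δ^{(K)})⁻¹(b, b′) = a_K⁻¹·[b = b′] + |Ω|⁻¹ Σ_q S_K(q)·Re e^{iq·(b′ − b)}` with `S_K = Sfib Nf M Nf² m²`.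
[cite: King1986, (2.13)–(2.14) p.653, (4.5) p.670, (4.35) p.674] -/
theorem blockCov_eq_fourier (Nf : ℕ) [NeZero Nf] (hNf : 1 ≤ Nf) (M : Fin (d + 1) → ℕ) [∀ μ, NeZero (M μ)] {a m2 : ℝ} {K : ℕ}
    (haK : 0 < aK a L K) (hm : 0 < m2) (b b' : Tor M) :
    blockCov L Nf M a m2 K b b'
      = (aK a L K)⁻¹ * (if b = b' then 1 else 0)
        + (Fintype.card (Tor M) : ℝ)⁻¹ * ∑ q : Tor M, Sfib Nf M (((Nf : ℕ) : ℝ) ^ 2) m2 q * (chi M q (b' - b)).re := by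
  unfold blockCov
  exact effLaplacian_inv_apply_eq_fourier Nf M hNf haK hm b b'

/-- The same at King's levels `Nf = L^K`, `K ≥ 1`, `L ≥ 2`, `a > 0`. [cite: King1986, (2.13)–(2.14) p.653, (4.5) p.670] -/
theorem blockCov_pow_eq_fourier (hL : 2 ≤ L) (M : Fin (d + 1) → ℕ) [∀ μ, NeZero (M μ)] {a m2 : ℝ} (ha : 0 < a) (hm : 0 < m2) {K : ℕ} (hK : 1 ≤ K)
    (b b' : Tor M) :
    blockCov L (L ^ K) M a m2 K b b'
      = (aK a L K)⁻¹ * (if b = b' then 1 else 0)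
        + (Fintype.card (Tor M) : ℝ)⁻¹ * ∑ q : Tor M, Sfib (L ^ K) M (((L ^ K : ℕ) : ℝ) ^ 2) m2 q * (chi M q (b' - b)).re := by
  have hL1 : (1 : ℝ) < L := by exact_mod_cast (show 1 < L by omega)
  have hN1 : 1 ≤ L ^ K := Nat.one_le_pow _ _ (by omega)
  exact blockCov_eq_fourier L (L ^ K) hN1 M (aK_pos ha hL1 hK) hm b b'

end Rung

end Summit.QuantumFields.YangMills.BalabanUVNodes.N15KingModelRung

end
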